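import Summits.Ventures.CertifiedQuantumChemistry.Rows.HubbardRingTVHoppingSign
import Summits.Ventures.CertifiedQuantumChemistry.Rows.HubbardRingTVDoublonBound
import Literature.MathematicalPhysics.QuantumChemistry.ParticleHoleConjugation
import Literature.MathematicalPhysics.QuantumChemistry.SectorRayleighRitz
import HarnessLib

/-!
# Ventures/CertifiedQuantumChemistry — Rows/HubbardRingTVParticleHole.lean: the PARTICLE–HOLE map on
# the TV-H ring — `E₀(L; −t, U; L−a, L−b) = E₀(L; t, U; a, b) + U·(L − a − b)`, the same for `OPT_DQG`,
# and the certified gap of the sector `(a, b)` equals that of `(L−a, L−b)`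

HONEST FRAMING (verbatim): certified bounds for a stated model Hamiltonian in a stated basis; not a
claim about the real molecule beyond that model.

Seat rdm-B, ROWS courtesy file (theorems only; no `def`, no notation, no instance; zero compute). The
tree's Literature files `ParticleHoleConjugation.lean` / `RelaxationParticleHoleEnergy.lean` prove the
particle–hole duality of BOTH the exact sector energy and the `S_z`-sector DQG value for arbitrary
integral tables: `E₀[h, g, h_nuc](a, b) = E₀[h̄, ḡ, h̄_nuc](|Λ|−a, |Λ|−b)` and the same for `E_PQG`, with
Mazziotti's hole tables `holeOneBody`, `holeTwoBody`, `holeConstant`. This file computes the hole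
tables of the cell's model `hubbardRingTV L t U` and reads the duality on the cell's objects:

* §1 (abstract `Λ`) a CHEMICAL-POTENTIAL / CONSTANT SHIFT of the tables, `h ↦ h + c·δ`,
  `h_nuc ↦ h_nuc + d`: `ParticleHole.rdmEnergy_shift` (the functional moves by `c·Σ_pσ γ_{pσ,pσ} + d`),
  `rdmEnergy_shift_of_sector` (`= c(a+b) + d` on sector-feasible pairs), **`pqgSectorEnergy_shift`** and
  **`sectorGroundEnergy_shift`** (both the relaxation value and the exact sector energy move by
  `Re(c(a+b) + d)`; the exact side by the two-sided variational argument with ground states as trial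
  states and their reduced density matrices as the bookkeeping device).
* §2 THE HOLE TABLES OF THE RING: `hubbardRingTV_holeTwoBody` (`ḡ = g`: on-site, symmetric),
  `hubbardRingTV_holeOneBody` (`h̄ = h(−t) − U·δ`: the hopping changes sign and the filled band's
  Hartree–exchange field is the constant `−U` per electron), `hubbardRingTV_holeConstant`
  (`h̄_nuc = L·U`, the energy of the completely filled ring).
* §3 **`hubbardRingTV_energy_particleHole`**: for `a, b ≤ L` and every `t, U`,
  `E₀(L; −t, U; L−a, L−b) = E₀(L; t, U; a, b) + U·(L − a − b)`; **`hubbardRingTV_pqgSectorEnergy_particleHole`**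
  (the same identity for `OPT_DQG`); **`hubbardRingTV_gap_particleHole`**
  (`E₀ − OPT_DQG` at `(L; −t, U; L−a, L−b)` EQUALS `E₀ − OPT_DQG` at `(L; t, U; a, b)`); for EVEN `L`
  (the sublattice gauge of `Rows/HubbardRingTVHoppingSign.lean` removes the sign of `t`)
  `hubbardRingTV_energy_particleHole_even`, `…_pqgSectorEnergy_particleHole_even`,
  **`hubbardRingTV_gap_particleHole_even`**: the certified DQG gap of the `(a, b)` sector of
  `hubbardRingTV L t U` equals that of the `(L−a, L−b)` sector — hole doping and electron doping of the
  half-filled ring are certified with the same gap, and the sectors with `a + b > L` carry no new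
  information.

READING: identities between values of the cell's own model object at different sectors / hopping
signs; no certificate, row, claim node or value of record depends on them (a row for `(a, b)` could be
TRANSPORTED to `(L−a, L−b)` by these identities, but no such row is written here). The singlet level
is not treated. All PROVED (0 sorry, standard axioms); no definitions, no named facts.

References (docstring-only): D. A. Mazziotti, Adv. Chem. Phys. 134 (2007) ch. 3 §II.E.2–3 (hole
representation), §II.F; M. B. Ruskai, J. Math. Phys. 11 (1970) 3218 (particle–hole equivalence);
E. H. Lieb, F. Y. Wu, Phys. Rev. Lett. 20 (1968) 1445 (particle–hole symmetry of the Hubbard chain,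
`E(L−a, L−b) = E(a, b) + U(L − a − b)` on bipartite lattices). Tree (REUSED):
`sectorGroundEnergy_particleHole`, `pqgSectorEnergy_particleHole`, `holeOneBody`, `holeTwoBody(_apply)`,
`holeConstant` (Literature), `exists_unit_eigen_sectorGroundEnergy`, `sectorGroundEnergy_le_re_rayleigh_of_unit`,
`rdmEnergy_rdm`, `IsDQGFeasibleSector.of_state`, `le_pqgSectorEnergy_iff`, `pqgSectorEnergy_le_rdmEnergy`,
`StrongCouplingDoublon.hubbardRingTV_eri`, `hubbardRingTV_h_diag`, gen 37's
`hubbardRingTV_energy_neg_hopping` / `hubbardRingTV_pqgSectorEnergy_neg_hopping`.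
-/

noncomputable section

namespace Summit.Ventures.CertifiedQuantumChemistry

open Matrix Finset
open Literature.MathematicalPhysics.QuantumLattice Literature.MathematicalPhysics.QuantumChemistry
open Summit.Ventures.CertifiedQuantumChemistry.Hamiltonians
open scoped ComplexOrder

/-! ## §1 Chemical-potential and constant shifts of the tables -/

namespace ParticleHole

section Shift

variable {Λ : Type*} [LinearOrder Λ] [Fintype Λ]
variable (h : Λ → Λ → ℂ) (g : Λ → Λ → Λ → Λ → ℂ) (hnuc c d : ℂ)

/-- **The functional under `h ↦ h + c·δ`, `h_nuc ↦ h_nuc + d`**: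
`E'(γ, Γ) = E(γ, Γ) + c·Σ_{pσ} γ_{pσ,pσ} + d` for every pair. [folklore] -/
theorem rdmEnergy_shift (γ : Matrix (Orb Λ) (Orb Λ) ℂ) (Γ : Matrix (Orb Λ × Orb Λ) (Orb Λ × Orb Λ) ℂ) :
    rdmEnergy (fun p q => h p q + if p = q then c else 0) g (hnuc + d) γ Γ =
      rdmEnergy h g hnuc γ Γ + (c * ∑ p : Λ, ∑ σ : Fin 2, γ (orb p σ) (orb p σ) + d) := by
  unfold rdmEnergy
  have key : ∀ p : Λ, ∑ q : Λ, (h p q + if p = q then c else 0) * ∑ σ : Fin 2, γ (orb p σ) (orb q σ) =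
      ∑ q : Λ, h p q * ∑ σ : Fin 2, γ (orb p σ) (orb q σ) + c * ∑ σ : Fin 2, γ (orb p σ) (orb p σ) := by
    intro p
    simp only [add_mul, Finset.sum_add_distrib, ite_mul, zero_mul, Finset.sum_ite_eq, Finset.mem_univ,
      if_true]
  simp only [key, Finset.sum_add_distrib, ← Finset.mul_sum]
  ring

/-- On an `(a, b)`-sector-feasible pair the shift is the constant `c(a + b) + d`. [folklore] -/
theorem rdmEnergy_shift_of_sector {a b : ℕ} {γ : Matrix (Orb Λ) (Orb Λ) ℂ}
    {Γ : Matrix (Orb Λ × Orb Λ) (Orb Λ × Orb Λ) ℂ} (hf : IsDQGFeasibleSector a b γ Γ) :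
    rdmEnergy (fun p q => h p q + if p = q then c else 0) g (hnuc + d) γ Γ =
      rdmEnergy h g hnuc γ Γ + (c * ((a : ℂ) + b) + d) := by
  rw [rdmEnergy_shift]
  have hs : ∑ p : Λ, ∑ σ : Fin 2, γ (orb p σ) (orb p σ) = (a : ℂ) + b := by
    simp only [Fin.sum_univ_two, Finset.sum_add_distrib, hf.trace_up, hf.trace_down]
  rw [hs]

/-- **The `S_z`-sector DQG value under the shift**: `E_PQG'(a, b) = E_PQG(a, b) + Re(c(a+b) + d)`
(`a, b ≤ |Λ|`; the feasible set is unchanged, the functional moves by a constant on it). [folklore] -/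
theorem pqgSectorEnergy_shift {a b : ℕ} (ha : a ≤ Fintype.card Λ) (hb : b ≤ Fintype.card Λ) :
    pqgSectorEnergy (fun p q => h p q + if p = q then c else 0) g (hnuc + d) a b =
      pqgSectorEnergy h g hnuc a b + (c * ((a : ℂ) + b) + d).re := by
  refine le_antisymm ?_ ?_
  · rw [← sub_le_iff_le_add, le_pqgSectorEnergy_iff h g hnuc ha hb]
    intro γ Γ hf
    have h1 := pqgSectorEnergy_le_rdmEnergy (fun p q => h p q + if p = q then c else 0) g (hnuc + d) hf
    rw [rdmEnergy_shift_of_sector h g hnuc c d hf, Complex.add_re] at h1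
    linarith
  · rw [le_pqgSectorEnergy_iff _ g _ ha hb]
    intro γ Γ hf
    rw [rdmEnergy_shift_of_sector h g hnuc c d hf]
    simp only [Complex.add_re]
    linarith [pqgSectorEnergy_le_rdmEnergy h g hnuc hf]

/-- **The exact sector energy under the shift**: `E₀'(a, b) = E₀(a, b) + Re(c(a+b) + d)` (`a, b ≤ |Λ|`,
both Hamiltonians Hermitian) — the variational principle in both directions, each with the other
Hamiltonian's ground state as trial state, the energy read through the state's reduced density
matrices (`rdmEnergy_rdm`, `IsDQGFeasibleSector.of_state`). [folklore] -/
theorem sectorGroundEnergy_shift {a b : ℕ} (ha : a ≤ Fintype.card Λ) (hb : b ≤ Fintype.card Λ)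
    (hH : (molecularHamiltonian h g hnuc).IsHermitian)
    (hH' : (molecularHamiltonian (fun p q => h p q + if p = q then c else 0) g (hnuc + d)).IsHermitian) :
    sectorGroundEnergy (molecularHamiltonian (fun p q => h p q + if p = q then c else 0) g (hnuc + d)) a b =
      sectorGroundEnergy (molecularHamiltonian h g hnuc) a b + (c * ((a : ℂ) + b) + d).re := by
  refine le_antisymm ?_ ?_
  · obtain ⟨ψ, hψ, hψ1, hHψ⟩ := exists_unit_eigen_sectorGroundEnergy hH ha hb
    have hf := IsDQGFeasibleSector.of_state hψ hψ1
    have h1 := sectorGroundEnergy_le_re_rayleigh_of_unit hH' hψ hψ1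
    rw [← rdmEnergy_rdm _ _ _ hψ1, rdmEnergy_shift_of_sector h g hnuc c d hf, Complex.add_re,
      rdmEnergy_rdm _ _ _ hψ1, hHψ, dotProduct_smul, hψ1, smul_eq_mul, mul_one, Complex.ofReal_re] at h1
    exact h1
  · obtain ⟨ψ, hψ, hψ1, hHψ⟩ := exists_unit_eigen_sectorGroundEnergy hH' ha hb
    have hf := IsDQGFeasibleSector.of_state hψ hψ1
    have h1 := sectorGroundEnergy_le_re_rayleigh_of_unit hH hψ hψ1
    have h2 := rdmEnergy_shift_of_sector h g hnuc c d hf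
    rw [rdmEnergy_rdm _ _ _ hψ1, rdmEnergy_rdm _ _ _ hψ1, hHψ, dotProduct_smul, hψ1, smul_eq_mul,
      mul_one] at h2
    have h3 := congrArg Complex.re h2
    rw [Complex.ofReal_re, Complex.add_re] at h3
    linarith

end Shift

end ParticleHole

/-! ## §2 The hole tables of `hubbardRingTV L t U` -/

section HoleTables

variable (L : ℕ) (t U : ℚ)

/-- The two-electron table does not depend on the hopping. -/
theorem hubbardRingTV_eri_neg_t : (hubbardRingTV L (-t) U).eri = (hubbardRingTV L t U).eri := rfl

/-- The constant does not depend on the hopping (it is `0`). -/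
theorem hubbardRingTV_ecore_eq_zero : ((hubbardRingTV L t U).ecore : ℂ) = 0 := by
  simp [hubbardRingTV]

/-- **`ḡ = g`**: the hole two-body table of the ring is its own two-body table (on-site, symmetric). -/
theorem hubbardRingTV_holeTwoBody :
    holeTwoBody (fun p q r s => ((hubbardRingTV L t U).eri p q r s : ℂ)) =
      fun p q r s => ((hubbardRingTV L (-t) U).eri p q r s : ℂ) := by
  funext p q r s
  rw [holeTwoBody_apply, StrongCouplingDoublon.hubbardRingTV_eri, StrongCouplingDoublon.hubbardRingTV_eri]
  by_cases h1 : p = q ∧ q = r ∧ r = s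
  · obtain ⟨rfl, rfl, rfl⟩ := h1
    simp
  · rw [if_neg h1, if_neg]
    rintro ⟨e1, e2, e3⟩
    exact h1 ⟨e1.symm, e1 ▸ e2 ▸ e3 ▸ rfl, e3.symm⟩

/-- The hopping table with the sign of `t` reversed, entrywise: `−h(t)_qp = h(−t)_pq`. -/
theorem hubbardRingTV_neg_h_swap (p q : Fin L) :
    -((hubbardRingTV L t U).h q p : ℂ) = ((hubbardRingTV L (-t) U).h p q : ℂ) := by
  simp only [hubbardRingTV]
  by_cases h1 : Hamiltonians.ringAdj L p q
  · rw [if_pos h1, if_pos (ringAdj_comm.1 h1)]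
    push_cast
    ring
  · rw [if_neg h1, if_neg (fun h2 => h1 (ringAdj_comm.1 h2))]
    simp

/-- The direct part of the filled band's field: `Σ_r ((qp|rr) + (rr|qp)) = 2U·δ_pq`. -/
theorem hubbardRingTV_sum_eri_direct (p q : Fin L) :
    ∑ r : Fin L, (((hubbardRingTV L t U).eri q p r r : ℂ) + ((hubbardRingTV L t U).eri r r q p : ℂ)) =
      if p = q then 2 * (((U : ℝ) : ℝ) : ℂ) else 0 := by
  by_cases hpq : p = q
  · subst hpq
    rw [if_pos rfl, Finset.sum_eq_single_of_mem p (Finset.mem_univ p)]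
    · simp [StrongCouplingDoublon.hubbardRingTV_eri, two_mul]
    · intro r _ hr
      simp [StrongCouplingDoublon.hubbardRingTV_eri, hr, Ne.symm hr]
  · rw [if_neg hpq]
    refine Finset.sum_eq_zero fun r _ => ?_
    have h1 : ¬ (q = p ∧ p = r ∧ r = r) := fun hh => hpq hh.1.symm
    have h2 : ¬ (r = r ∧ r = q ∧ q = p) := fun hh => hpq hh.2.2.symm
    rw [StrongCouplingDoublon.hubbardRingTV_eri, StrongCouplingDoublon.hubbardRingTV_eri, if_neg h1,
      if_neg h2, add_zero]

/-- The exchange part of the filled band's field: `Σ_r ((qr|rp) + (rp|qr)) = 2U·δ_pq`. -/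
theorem hubbardRingTV_sum_eri_exchange (p q : Fin L) :
    ∑ r : Fin L, (((hubbardRingTV L t U).eri q r r p : ℂ) + ((hubbardRingTV L t U).eri r p q r : ℂ)) =
      if p = q then 2 * (((U : ℝ) : ℝ) : ℂ) else 0 := by
  by_cases hpq : p = q
  · subst hpq
    rw [if_pos rfl, Finset.sum_eq_single_of_mem p (Finset.mem_univ p)]
    · simp [StrongCouplingDoublon.hubbardRingTV_eri, two_mul]
    · intro r _ hr
      simp [StrongCouplingDoublon.hubbardRingTV_eri, hr, Ne.symm hr]
  · rw [if_neg hpq]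
    refine Finset.sum_eq_zero fun r _ => ?_
    have h1 : ¬ (q = r ∧ r = r ∧ r = p) := fun hh => hpq (hh.1.trans hh.2.2).symm
    have h2 : ¬ (r = p ∧ p = q ∧ q = r) := fun hh => hpq hh.2.1
    rw [StrongCouplingDoublon.hubbardRingTV_eri, StrongCouplingDoublon.hubbardRingTV_eri, if_neg h1,
      if_neg h2, add_zero]

/-- **`h̄ = h(−t) − U·δ`**: the hole one-body table of `hubbardRingTV L t U` is the one-body table of
`hubbardRingTV L (−t) U` shifted by the chemical potential `−U` (the filled band's `2J − K = U` per
orbital). -/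
theorem hubbardRingTV_holeOneBody :
    holeOneBody (fun p q => ((hubbardRingTV L t U).h p q : ℂ))
        (fun p q r s => ((hubbardRingTV L t U).eri p q r s : ℂ)) =
      fun p q => ((hubbardRingTV L (-t) U).h p q : ℂ) + if p = q then -(((U : ℝ) : ℝ) : ℂ) else 0 := by
  funext p q
  simp only [holeOneBody]
  rw [hubbardRingTV_sum_eri_direct, hubbardRingTV_sum_eri_exchange, hubbardRingTV_neg_h_swap]
  split_ifs <;> ring

/-- **`h̄_nuc = L·U`**: the hole constant of `hubbardRingTV L t U` is the energy of the completely
filled ring. -/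
theorem hubbardRingTV_holeConstant :
    holeConstant (fun p q => ((hubbardRingTV L t U).h p q : ℂ))
        (fun p q r s => ((hubbardRingTV L t U).eri p q r s : ℂ)) ((hubbardRingTV L t U).ecore : ℂ) =
      ((hubbardRingTV L (-t) U).ecore : ℂ) + (L : ℂ) * (((U : ℝ) : ℝ) : ℂ) := by
  have inner : ∀ p : Fin L, ∑ r : Fin L, (2 * ((hubbardRingTV L t U).eri p p r r : ℂ) -
      ((hubbardRingTV L t U).eri p r r p : ℂ)) = (((U : ℝ) : ℝ) : ℂ) := by
    intro p
    rw [Finset.sum_eq_single_of_mem p (Finset.mem_univ p)]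
    · simp only [StrongCouplingDoublon.hubbardRingTV_eri, and_self, if_true]
      ring
    · intro r _ hr
      simp [StrongCouplingDoublon.hubbardRingTV_eri, hr, Ne.symm hr]
  simp only [holeConstant, StrongCouplingDoublon.hubbardRingTV_h_diag, hubbardRingTV_ecore_eq_zero, inner,
    Finset.sum_const_zero, mul_zero, zero_add, Finset.sum_const, Finset.card_univ, Fintype.card_fin,
    nsmul_eq_mul]

/-- The shifted one-body table keeps the Hermitian symmetry (`U` is real). -/
theorem hubbardRingTV_hamiltonian_shift_isHermitian (c d : ℝ) :
    (molecularHamiltonian (fun p q => ((hubbardRingTV L t U).h p q : ℂ) + if p = q then (c : ℂ) else 0)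
      (fun p q r s => ((hubbardRingTV L t U).eri p q r s : ℂ))
      (((hubbardRingTV L t U).ecore : ℂ) + d)).IsHermitian := by
  refine molecularHamiltonian_isHermitian (fun p q => ?_) (fun p q r s => ?_) ?_
  · rw [star_add, Complex.star_def, map_ratCast, (hubbardRingTV_isSymmetric L t U).1 p q]
    by_cases hpq : p = q
    · subst hpq; simp [Complex.conj_ofReal]
    · simp [hpq, Ne.symm hpq]
  · rw [Complex.star_def, map_ratCast, (hubbardRingTV_isSymmetric L t U).2 p q r s]
  · rw [star_add, Complex.star_def, map_ratCast, Complex.conj_ofReal]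

end HoleTables

/-! ## §3 The particle–hole identities on the ring -/

section Ring

variable {L : ℕ}

/-- **PARTICLE–HOLE SYMMETRY OF THE EXACT SECTOR ENERGY OF THE RING**: for `a, b ≤ L` and every `t, U`,
`E₀(hubbardRingTV L (−t) U; L−a, L−b) = E₀(hubbardRingTV L t U; a, b) + U·(L − a − b)` (the tree's
particle–hole unitary carries the `(a, b)` sector onto the `(L−a, L−b)` sector and `Ĥ(t, U)` onto
`Ĥ(−t, U) − U·N̂ + L·U`). [folklore] -/
theorem hubbardRingTV_energy_particleHole (t U : ℚ) {a b : ℕ} (ha : a ≤ L) (hb : b ≤ L) :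
    Model.energy (hubbardRingTV L (-t) U) (L - a) (L - b) =
      Model.energy (hubbardRingTV L t U) a b + (U : ℝ) * ((L : ℝ) - a - b) := by
  have ha' : a ≤ Fintype.card (Fin L) := by rw [Fintype.card_fin]; exact ha
  have hb' : b ≤ Fintype.card (Fin L) := by rw [Fintype.card_fin]; exact hb
  have hLa : L - a ≤ Fintype.card (Fin L) := by rw [Fintype.card_fin]; omega
  have hLb : L - b ≤ Fintype.card (Fin L) := by rw [Fintype.card_fin]; omega
  -- the duality for arbitrary tables, on the ring's tables
  have hdual := sectorGroundEnergy_particleHole (fun p q => ((hubbardRingTV L t U).h p q : ℂ))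
    (fun p q r s => ((hubbardRingTV L t U).eri p q r s : ℂ)) ((hubbardRingTV L t U).ecore : ℂ) ha' hb'
  rw [Fintype.card_fin, hubbardRingTV_holeOneBody, hubbardRingTV_holeTwoBody, hubbardRingTV_holeConstant]
    at hdual
  -- the shifted tables of `hubbardRingTV L (-t) U`
  have hshift := ParticleHole.sectorGroundEnergy_shift (fun p q => ((hubbardRingTV L (-t) U).h p q : ℂ))
    (fun p q r s => ((hubbardRingTV L (-t) U).eri p q r s : ℂ)) ((hubbardRingTV L (-t) U).ecore : ℂ)
    (-(((U : ℝ) : ℝ) : ℂ)) ((L : ℂ) * (((U : ℝ) : ℝ) : ℂ)) hLa hLb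
    (hubbardRingTV_hamiltonian_isHermitian L (-t) U)
    (by simpa using hubbardRingTV_hamiltonian_shift_isHermitian L (-t) U (-(U : ℝ)) ((L : ℝ) * U))
  unfold Model.energy Model.hamiltonian
  rw [hdual, hshift]
  have hre : (-(((U : ℝ) : ℝ) : ℂ) * (((L - a : ℕ) : ℂ) + ((L - b : ℕ) : ℂ)) + (L : ℂ) * (((U : ℝ) : ℝ) : ℂ)).re =
      -((U : ℝ) * ((L : ℝ) - a - b)) := by
    have e1 : ((L - a : ℕ) : ℂ) = (L : ℂ) - a := by push_cast [Nat.cast_sub ha]; ring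
    have e2 : ((L - b : ℕ) : ℂ) = (L : ℂ) - b := by push_cast [Nat.cast_sub hb]; ring
    rw [e1, e2]
    simp only [Complex.add_re, Complex.neg_re, Complex.mul_re, Complex.sub_re, Complex.ofReal_re,
      Complex.ofReal_im, Complex.natCast_re, Complex.natCast_im, Complex.sub_im, Complex.add_im]
    push_cast
    ring
  rw [hre]
  ring

/-- **PARTICLE–HOLE SYMMETRY OF THE `S_z`-SECTOR DQG VALUE OF THE RING**: for `a, b ≤ L` and every `t, U`,
`OPT_DQG(hubbardRingTV L (−t) U; L−a, L−b) = OPT_DQG(hubbardRingTV L t U; a, b) + U·(L − a − b)` (the hole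
map `(γ, Γ) ↦ (1 − γᵀ, Q(γ, Γ))` is a bijection of the feasible sets carrying the functional along).
[folklore] -/
theorem hubbardRingTV_pqgSectorEnergy_particleHole (t U : ℚ) {a b : ℕ} (ha : a ≤ L) (hb : b ≤ L) :
    Model.pqgSectorEnergy (hubbardRingTV L (-t) U) (L - a) (L - b) =
      Model.pqgSectorEnergy (hubbardRingTV L t U) a b + (U : ℝ) * ((L : ℝ) - a - b) := by
  have ha' : a ≤ Fintype.card (Fin L) := by rw [Fintype.card_fin]; exact ha
  have hb' : b ≤ Fintype.card (Fin L) := by rw [Fintype.card_fin]; exact hb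
  have hLa : L - a ≤ Fintype.card (Fin L) := by rw [Fintype.card_fin]; omega
  have hLb : L - b ≤ Fintype.card (Fin L) := by rw [Fintype.card_fin]; omega
  have hdual := pqgSectorEnergy_particleHole (fun p q => ((hubbardRingTV L t U).h p q : ℂ))
    (fun p q r s => ((hubbardRingTV L t U).eri p q r s : ℂ)) ((hubbardRingTV L t U).ecore : ℂ) ha' hb'
  rw [Fintype.card_fin, hubbardRingTV_holeOneBody, hubbardRingTV_holeTwoBody, hubbardRingTV_holeConstant]
    at hdual
  have hshift := ParticleHole.pqgSectorEnergy_shift (fun p q => ((hubbardRingTV L (-t) U).h p q : ℂ))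
    (fun p q r s => ((hubbardRingTV L (-t) U).eri p q r s : ℂ)) ((hubbardRingTV L (-t) U).ecore : ℂ)
    (-(((U : ℝ) : ℝ) : ℂ)) ((L : ℂ) * (((U : ℝ) : ℝ) : ℂ)) hLa hLb
  unfold Model.pqgSectorEnergy
  rw [hdual, hshift]
  have hre : (-(((U : ℝ) : ℝ) : ℂ) * (((L - a : ℕ) : ℂ) + ((L - b : ℕ) : ℂ)) + (L : ℂ) * (((U : ℝ) : ℝ) : ℂ)).re =
      -((U : ℝ) * ((L : ℝ) - a - b)) := by
    have e1 : ((L - a : ℕ) : ℂ) = (L : ℂ) - a := by push_cast [Nat.cast_sub ha]; ring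
    have e2 : ((L - b : ℕ) : ℂ) = (L : ℂ) - b := by push_cast [Nat.cast_sub hb]; ring
    rw [e1, e2]
    simp only [Complex.add_re, Complex.neg_re, Complex.mul_re, Complex.sub_re, Complex.ofReal_re,
      Complex.ofReal_im, Complex.natCast_re, Complex.natCast_im, Complex.sub_im, Complex.add_im]
    push_cast
    ring
  rw [hre]
  ring

/-- **THE CERTIFIED GAP IS PARTICLE–HOLE INVARIANT**: for `a, b ≤ L` and every `t, U`,
`(E₀ − OPT_DQG)(hubbardRingTV L (−t) U; L−a, L−b) = (E₀ − OPT_DQG)(hubbardRingTV L t U; a, b)`. [folklore] -/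
theorem hubbardRingTV_gap_particleHole (t U : ℚ) {a b : ℕ} (ha : a ≤ L) (hb : b ≤ L) :
    Model.energy (hubbardRingTV L (-t) U) (L - a) (L - b) -
        Model.pqgSectorEnergy (hubbardRingTV L (-t) U) (L - a) (L - b) =
      Model.energy (hubbardRingTV L t U) a b - Model.pqgSectorEnergy (hubbardRingTV L t U) a b := by
  rw [hubbardRingTV_energy_particleHole t U ha hb, hubbardRingTV_pqgSectorEnergy_particleHole t U ha hb]
  ring

/-- **EVEN RINGS: particle–hole symmetry at the SAME hopping** (the sublattice gauge removes the sign
of `t`, `Rows/HubbardRingTVHoppingSign.lean`): for even `L`, `a, b ≤ L`,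
`E₀(hubbardRingTV L t U; L−a, L−b) = E₀(hubbardRingTV L t U; a, b) + U·(L − a − b)`. [folklore] -/
theorem hubbardRingTV_energy_particleHole_even (hL : Even L) (t U : ℚ) {a b : ℕ} (ha : a ≤ L)
    (hb : b ≤ L) :
    Model.energy (hubbardRingTV L t U) (L - a) (L - b) =
      Model.energy (hubbardRingTV L t U) a b + (U : ℝ) * ((L : ℝ) - a - b) := by
  rw [← hubbardRingTV_energy_neg_hopping hL t U (L - a) (L - b)]
  exact hubbardRingTV_energy_particleHole t U ha hb

/-- Even rings, relaxation value: `OPT_DQG(L; t, U; L−a, L−b) = OPT_DQG(L; t, U; a, b) + U·(L − a − b)`.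
[folklore] -/
theorem hubbardRingTV_pqgSectorEnergy_particleHole_even (hL : Even L) (t U : ℚ) {a b : ℕ} (ha : a ≤ L)
    (hb : b ≤ L) :
    Model.pqgSectorEnergy (hubbardRingTV L t U) (L - a) (L - b) =
      Model.pqgSectorEnergy (hubbardRingTV L t U) a b + (U : ℝ) * ((L : ℝ) - a - b) := by
  rw [← hubbardRingTV_pqgSectorEnergy_neg_hopping hL t U (L - a) (L - b)]
  exact hubbardRingTV_pqgSectorEnergy_particleHole t U ha hb

/-- **EVEN RINGS: THE CERTIFIED DQG GAP OF THE `(a, b)` SECTOR EQUALS THAT OF THE `(L−a, L−b)` SECTOR**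
(same `t`, same `U`; hole doping and electron doping of the half-filled ring are certified with the same
gap). [folklore] -/
theorem hubbardRingTV_gap_particleHole_even (hL : Even L) (t U : ℚ) {a b : ℕ} (ha : a ≤ L) (hb : b ≤ L) :
    Model.energy (hubbardRingTV L t U) (L - a) (L - b) -
        Model.pqgSectorEnergy (hubbardRingTV L t U) (L - a) (L - b) =
      Model.energy (hubbardRingTV L t U) a b - Model.pqgSectorEnergy (hubbardRingTV L t U) a b := by
  rw [hubbardRingTV_energy_particleHole_even hL t U ha hb,
    hubbardRingTV_pqgSectorEnergy_particleHole_even hL t U ha hb]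
  ring

end Ring

end Summit.Ventures.CertifiedQuantumChemistry

end
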